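import Mathlib
import Literature.Computability.Complexity.CliqueTestGraphs
import Literature.Combinatorics.SimpleGraph.LovaszThetaDual
import Summits.PneNP.PneNP.Theorems.ConvexRankGatesConvexGateBlindColouringTheta
import Summits.PneNP.PneNP.Theorems.ConvexRankGatesConvexGateBlindRainbowMarginals

/-!
# PneNP / ConvexRankGates — `ConvexGateBlind`: junta (local) LP certificates are ε-exactly blind on colouring columns

Helpers (`--supports stmt-PneNP-10680`), concluding `…RainbowSums.lean` / `…RainbowFunctional.lean`.
On a COLOURING column `u = colorVec h` (`h : Fin m → Fin K` balanced with classes of size `n ≥ K + 1`, `k = K + 1`)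
the canonical matrix entry of the crux is `cdist Q (colorVec h) = mono_h(Q)`, the number of monochromatic pairs of the
`(K+1)`-set `Q` (`two_mul_cdist_colorVec`). THEOREM (`cdist_colorVec_not_juntaRep`, registered stub `junta_blind`):
for `2 ≤ K`, `K + 1 ≤ n`, `2t ≤ K` and EVERY `ε > 0` there is NO identity

  `cdist Q (colorVec h) - ε = ∑_l F_l (Q ∩ S_l)`   on the `(K+1)`-sets `Q`,   `F_l ≥ 0`, `#S_l ≤ t`,

whatever the (finite) number of terms — equivalently (`cdist_colorVec_no_juntaFactorisation`) the colouring columns of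
`D - εJ` admit no non-negative factorisation `∑_l W_{h,l} V_l(Q)` whose row factors `V_l` are non-negative
`t`-JUNTAS (`V_l(Q) = G_l(Q ∩ S_l)`), of any size. The quantifier order is the crux's (`m` first, then all `ε > 0`):
unlike rectangle/corruption or lifting arguments this lower bound survives `ε → 0⁺` at fixed `m`. Proof: integrate the
identity against the RAINBOW PSEUDO-DISTRIBUTION (the one-clump functional `rbL` of `…RainbowFunctional.lean`): by its
inclusion numbers (`rbL_indicator`) `L(1) = K n^K/(K+1) > 0` and `L(mono_h) = 0` (a monochromatic pair is not rainbow), so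
the left side integrates to `-ε L(1) < 0`; while each junta integrates to `∑_P F_l(P) μ_{S_l}(P)` with the LOCAL LAW
`μ_S(P) = L(𝟙[· ∩ S = P]) = [P rainbow] K n^{K-#P} R_A(K+1-#P) ≥ 0` (`rbL_localLaw`; inclusion–exclusion from the
inclusion numbers, then `rbSum_nonneg`). Consequences recorded in the item evidence (ANALYSIS-seat2-s11.md): degree-`t`
Sherali–Adams / local LP certificates and — via Yannakakis' junta lemma — symmetric LPs of size `< C(m, t+1)` cannot
separate `k`-cliques from complete `(k-1)`-partite graphs in the exact sense of the crux. [new]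
-/

namespace Summit.PneNP.PneNP.Theorems

open Finset Literature.Computability.Complexity
open Summit.PneNP.PneNP.Cruxes.ConvexGateBlind.StrictRankConicCover (Edge cdist monoPairs mem_monoPairs
  two_mul_cdist_colorVec)

noncomputable section

variable {m K : ℕ}

/-! ## Inclusion–exclusion: local patterns from inclusion indicators -/

/-- `𝟙[Q ∩ S = P] = ∑_{P ⊆ T ⊆ S} (-1)^{#(T ∖ P)} 𝟙[T ⊆ Q]` for `P ⊆ S`. [folklore] -/
theorem indicator_inter_eq (S P Q : Finset (Fin m)) (hPS : P ⊆ S) :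
    (if Q ∩ S = P then (1 : ℝ) else 0) =
      ∑ T ∈ (S \ P).powerset, (-1 : ℝ) ^ T.card * (if P ∪ T ⊆ Q then (1 : ℝ) else 0) := by
  classical
  by_cases hPQ : P ⊆ Q
  · -- the sum runs over `T ⊆ (S ∖ P) ∩ Q`
    have hterm : ∀ T ∈ (S \ P).powerset, (-1 : ℝ) ^ T.card * (if P ∪ T ⊆ Q then (1 : ℝ) else 0) =
        if T ⊆ (S \ P) ∩ Q then (-1 : ℝ) ^ T.card else 0 := by
      intro T hT
      rw [mem_powerset] at hT
      by_cases hTQ : T ⊆ Q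
      · rw [if_pos (union_subset hPQ hTQ), if_pos (subset_inter hT hTQ), mul_one]
      · rw [if_neg (fun hu => hTQ ((subset_union_right).trans hu)),
          if_neg (fun hs => hTQ (hs.trans inter_subset_right)), mul_zero]
    rw [Finset.sum_congr rfl hterm, ← Finset.sum_filter]
    have hset : ((S \ P).powerset.filter fun T => T ⊆ (S \ P) ∩ Q) = ((S \ P) ∩ Q).powerset := by
      ext T
      simp only [mem_filter, mem_powerset]
      constructor
      · exact fun hh => hh.2
      · exact fun hh => ⟨hh.trans inter_subset_left, hh⟩
    have key : ∑ T ∈ ((S \ P) ∩ Q).powerset, (-1 : ℝ) ^ T.card = if (S \ P) ∩ Q = ∅ then 1 else 0 := by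
      have := Finset.sum_powerset_neg_one_pow_card (x := (S \ P) ∩ Q)
      exact_mod_cast this
    rw [hset, key]
    by_cases hQ : Q ∩ S = P
    · rw [if_pos hQ, if_pos]
      rw [Finset.eq_empty_iff_forall_notMem]
      intro v hv
      rw [mem_inter, mem_sdiff] at hv
      have : v ∈ Q ∩ S := mem_inter.2 ⟨hv.2, hv.1.1⟩
      rw [hQ] at this
      exact hv.1.2 this
    · rw [if_neg hQ, if_neg]
      intro hempty
      apply hQ
      ext v
      simp only [mem_inter]
      constructor
      · rintro ⟨hvQ, hvS⟩
        by_contra hvP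
        have : v ∈ (S \ P) ∩ Q := mem_inter.2 ⟨mem_sdiff.2 ⟨hvS, hvP⟩, hvQ⟩
        rw [hempty] at this
        simp at this
      · exact fun hvP => ⟨hPQ hvP, hPS hvP⟩
  · -- `P ⊄ Q`: both sides vanish
    rw [if_neg (fun hQ : Q ∩ S = P => hPQ (hQ ▸ inter_subset_left))]
    symm
    refine Finset.sum_eq_zero fun T _ => ?_
    rw [if_neg (fun hu => hPQ (subset_union_left.trans hu)), mul_zero]

/-! ## The local laws of the rainbow pseudo-distribution -/

/-- Rainbowness of a disjoint union. -/
theorem injOn_union_iff (h : Fin m → Fin K) {P T : Finset (Fin m)} (hPT : Disjoint P T) :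
    Set.InjOn h ↑(P ∪ T) ↔
      Set.InjOn h ↑P ∧ Set.InjOn h ↑T ∧ ∀ v ∈ T, h v ∉ P.image h := by
  classical
  rw [coe_union]
  constructor
  · intro hu
    refine ⟨hu.mono Set.subset_union_left, hu.mono Set.subset_union_right, fun v hv hvP => ?_⟩
    obtain ⟨w, hw, hwv⟩ := mem_image.1 hvP
    have := hu (Set.mem_union_left _ (mem_coe.2 hw)) (Set.mem_union_right _ (mem_coe.2 hv)) hwv
    exact Finset.disjoint_left.1 hPT hw (this ▸ hv)
  · rintro ⟨hP, hT, hcol⟩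
    intro a ha b hb hab
    rcases ha with ha | ha <;> rcases hb with hb | hb
    · exact hP ha hb hab
    · exact (hcol b (mem_coe.1 hb) (mem_image.2 ⟨a, mem_coe.1 ha, hab⟩)).elim
    · exact (hcol a (mem_coe.1 ha) (mem_image.2 ⟨b, mem_coe.1 hb, hab.symm⟩)).elim
    · exact hT ha hb hab

/-- **Local law of the rainbow pseudo-distribution.** For `P ⊆ S`, `#S ≤ K`:
`L(𝟙[· ∩ S = P]) = [P rainbow] · K · n^{K - #P} · R_A(K + 1 - #P)` with `A` the vertices of `S ∖ P` whose colour is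
not used by `P` and `R_A` the rainbow alternating sum of `…RainbowSums.lean`. -/
theorem rbL_localLaw (h : Fin m → Fin K) {n : ℕ} (hn : ∀ c, (cls h c).card = n) (hKn : K + 1 ≤ n)
    {S P : Finset (Fin m)} (hPS : P ⊆ S) (hS : S.card ≤ K) :
    rbL h n (fun Q => if Q ∩ S = P then 1 else 0) =
      if Set.InjOn h ↑P then
        (K : ℝ) * (n : ℝ) ^ (K - P.card) *
          rbSum h (n : ℝ) ((S \ P).filter fun v => h v ∉ P.image h) ((K : ℝ) + 1 - P.card)
      else 0 := by
  classical
  set A := (S \ P).filter fun v => h v ∉ P.image h with hA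
  have hn0 : (n : ℝ) ≠ 0 := by
    have : 0 < n := by omega
    positivity
  -- inclusion–exclusion and the inclusion numbers
  rw [rbL_congr_fun h n (fun Q => indicator_inter_eq S P Q hPS), rbL_sum]
  have hterm : ∀ T ∈ (S \ P).powerset, rbL h n (fun Q => (-1 : ℝ) ^ T.card * (if P ∪ T ⊆ Q then (1 : ℝ) else 0)) =
      (-1 : ℝ) ^ T.card *
        (if Set.InjOn h ↑(P ∪ T) then (K : ℝ) * (n : ℝ) ^ (K - (P ∪ T).card) / ((K : ℝ) + 1 - (P ∪ T).card)
          else 0) := by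
    intro T hT
    rw [mem_powerset] at hT
    rw [rbL_smul, rbL_indicator h hn hKn]
    exact (card_le_card (union_subset hPS (hT.trans sdiff_subset))).trans hS
  rw [Finset.sum_congr rfl hterm]
  split_ifs with hP
  · -- reduce to the rainbow alternating sum over `A`
    rw [rbSum, Finset.mul_sum]
    -- the terms with `T ⊄ A` vanish; the others match
    have hsplit : ∀ T ∈ (S \ P).powerset,
        (-1 : ℝ) ^ T.card *
          (if Set.InjOn h ↑(P ∪ T) then (K : ℝ) * (n : ℝ) ^ (K - (P ∪ T).card) / ((K : ℝ) + 1 - (P ∪ T).card)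
            else 0) =
        if T ⊆ A then (K : ℝ) * (n : ℝ) ^ (K - P.card) *
          (if Set.InjOn h ↑T then (-1 : ℝ) ^ T.card * ((n : ℝ)⁻¹) ^ T.card / ((K : ℝ) + 1 - P.card - T.card)
            else 0) else 0 := by
      intro T hT
      rw [mem_powerset] at hT
      have hdisj : Disjoint P T := by
        rw [Finset.disjoint_left]
        intro v hvP hvT
        exact (mem_sdiff.1 (hT hvT)).2 hvP
      have hcardPT : (P ∪ T).card = P.card + T.card := card_union_of_disjoint hdisj
      have hTcard : P.card + T.card ≤ K := by
        rw [← hcardPT]; exact (card_le_card (union_subset hPS (hT.trans sdiff_subset))).trans hS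
      by_cases hTA : T ⊆ A
      · rw [if_pos hTA]
        by_cases hTinj : Set.InjOn h ↑T
        · have hcol : ∀ v ∈ T, h v ∉ P.image h := fun v hv => (mem_filter.1 (hTA hv)).2
          rw [if_pos ((injOn_union_iff h hdisj).2 ⟨hP, hTinj, hcol⟩), if_pos hTinj, hcardPT]
          have hpow : (n : ℝ) ^ (K - (P.card + T.card)) * (n : ℝ) ^ T.card = (n : ℝ) ^ (K - P.card) := by
            rw [← pow_add]; congr 1; omega
          have hden : (K : ℝ) + 1 - ((P.card + T.card : ℕ) : ℝ) = (K : ℝ) + 1 - P.card - T.card := by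
            push_cast; ring
          rw [hden, inv_pow]
          have hnT : (n : ℝ) ^ T.card ≠ 0 := pow_ne_zero _ hn0
          field_simp
          rw [← hpow]
          ring
        · rw [if_neg (fun hu => hTinj ((injOn_union_iff h hdisj).1 hu).2.1), if_neg hTinj]
          simp
      · rw [if_neg hTA, if_neg]
        · simp
        · intro hu
          apply hTA
          intro v hv
          exact mem_filter.2 ⟨hT hv, ((injOn_union_iff h hdisj).1 hu).2.2 v hv⟩
    rw [Finset.sum_congr rfl hsplit, ← Finset.sum_filter]
    have hAset : ((S \ P).powerset.filter fun T => T ⊆ A) = A.powerset := by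
      ext T
      simp only [mem_filter, mem_powerset]
      constructor
      · exact fun hh => hh.2
      · exact fun hh => ⟨hh.trans (filter_subset _ _), hh⟩
    rw [hAset]
  · refine Finset.sum_eq_zero fun T hT => ?_
    rw [if_neg, mul_zero]
    intro hu
    exact hP (hu.mono (by rw [coe_union]; exact Set.subset_union_left))

/-- **The local laws are non-negative** for `#S ≤ t`, `2 ≤ K`, `2t ≤ K`, `K + 1 ≤ n`. -/
theorem rbL_localLaw_nonneg (h : Fin m → Fin K) {n t : ℕ} (hn : ∀ c, (cls h c).card = n) (hK : 2 ≤ K)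
    (hKn : K + 1 ≤ n) (ht : 2 * t ≤ K) {S P : Finset (Fin m)} (hPS : P ⊆ S) (hS : S.card ≤ t) :
    0 ≤ rbL h n (fun Q => if Q ∩ S = P then 1 else 0) := by
  classical
  rw [rbL_localLaw h hn hKn hPS (by omega)]
  split_ifs with hP
  · refine mul_nonneg (by positivity) ?_
    set A := (S \ P).filter fun v => h v ∉ P.image h with hA
    have hAcard : A.card + P.card ≤ t := by
      have h1 : A.card ≤ (S \ P).card := card_filter_le _ _
      rw [card_sdiff_of_subset hPS] at h1
      have h2 := card_le_card hPS
      omega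
    have hnpos : (0 : ℝ) < n := by
      have : 0 < n := by omega
      positivity
    refine rbSum_nonneg h hnpos A _ ?_ ?_
    · have h1 : (A.card : ℝ) + P.card ≤ t := by exact_mod_cast hAcard
      have h2 : (t : ℝ) + 1 ≤ K := by exact_mod_cast (show t + 1 ≤ K by omega)
      linarith
    · have h1 : (A.card : ℝ) + P.card ≤ t := by exact_mod_cast hAcard
      have h2 : 2 * (t : ℝ) ≤ K := by exact_mod_cast ht
      have h3 : (K : ℝ) + 1 ≤ n := by exact_mod_cast hKn
      have h4 : (0 : ℝ) ≤ P.card := Nat.cast_nonneg _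
      linarith
  · exact le_refl _

/-! ## The functional on the two sides of a junta representation -/

/-- `L(1) = K n^K / (K+1) > 0`. -/
theorem rbL_one (h : Fin m → Fin K) {n : ℕ} (hn : ∀ c, (cls h c).card = n) (hKn : K + 1 ≤ n) :
    rbL h n (fun _ => 1) = (K : ℝ) * (n : ℝ) ^ K / ((K : ℝ) + 1) := by
  have := rbL_indicator h hn hKn ∅ (by simp)
  rw [rbL_congr_fun h n (f' := fun Q => if (∅ : Finset (Fin m)) ⊆ Q then (1 : ℝ) else 0)
    (fun Q => by simp), this, if_pos (by simp)]
  simp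

/-- `L(mono_h) = 0`: the functional kills the colouring column (every monochromatic pair is a non-rainbow pattern). -/
theorem rbL_cdist_colorVec (h : Fin m → Fin K) {n : ℕ} (hn : ∀ c, (cls h c).card = n) (hK : 2 ≤ K)
    (hKn : K + 1 ≤ n) : rbL h n (fun Q => cdist Q (colorVec h)) = 0 := by
  classical
  -- `2 cdist Q = #monoPairs h Q = ∑_{(a,b) mono, a ≠ b} 𝟙[{a,b} ⊆ Q]`
  set M := (univ : Finset (Fin m × Fin m)).filter fun p => p.1 ≠ p.2 ∧ h p.1 = h p.2 with hM
  have hcount : ∀ Q : Finset (Fin m), 2 * cdist Q (colorVec h) =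
      ∑ p ∈ M, (if ({p.1, p.2} : Finset (Fin m)) ⊆ Q then (1 : ℝ) else 0) := by
    intro Q
    rw [two_mul_cdist_colorVec, ← Finset.sum_filter]
    have hset : (M.filter fun p => ({p.1, p.2} : Finset (Fin m)) ⊆ Q) = monoPairs h Q := by
      ext p
      simp only [hM, mem_filter, mem_univ, true_and, mem_monoPairs, insert_subset_iff, singleton_subset_iff]
      tauto
    rw [hset, Finset.sum_const, nsmul_eq_mul, mul_one]
  have h2 : rbL h n (fun Q => 2 * cdist Q (colorVec h)) = 0 := by
    rw [rbL_congr_fun h n hcount, rbL_sum]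
    refine Finset.sum_eq_zero fun p hp => ?_
    obtain ⟨hne, hpq⟩ := (mem_filter.1 hp).2
    rw [rbL_indicator h hn hKn _ ((card_le_two).trans hK), if_neg]
    intro hinj
    exact hne (hinj (by simp) (by simp) hpq)
  rw [rbL_smul] at h2
  linarith

/-- **Junta (local) LP certificates are ε-exactly blind on colouring columns.** For a balanced colouring `h` with `K ≥ 2`
classes of size `n ≥ K + 1`, `2t ≤ K`, and every `ε > 0`: there is no representation
`cdist Q (colorVec h) - ε = ∑_l F_l (Q ∩ S_l)` on the `(K+1)`-sets with `F_l ≥ 0` and `#S_l ≤ t`. [new] -/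
theorem cdist_colorVec_not_juntaRep (h : Fin m → Fin K) {n t : ℕ} (hn : ∀ c, (cls h c).card = n) (hK : 2 ≤ K)
    (hKn : K + 1 ≤ n) (ht : 2 * t ≤ K) {ε : ℝ} (hε : 0 < ε) {ι : Type*} [Fintype ι] (S : ι → Finset (Fin m))
    (F : ι → Finset (Fin m) → ℝ) (hS : ∀ l, (S l).card ≤ t) (hF : ∀ l P, 0 ≤ F l P) :
    ¬ ∀ Q : Finset (Fin m), Q.card = K + 1 → cdist Q (colorVec h) - ε = ∑ l, F l (Q ∩ S l) := by
  classical
  intro hrep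
  -- integrate both sides against the rainbow pseudo-distribution
  have hL := rbL_congr h n hrep
  -- left side: `-ε L(1) < 0`
  have hleft : rbL h n (fun Q => cdist Q (colorVec h) - ε) = -(ε * ((K : ℝ) * (n : ℝ) ^ K / ((K : ℝ) + 1))) := by
    rw [rbL_sub, rbL_cdist_colorVec h hn hK hKn, zero_sub]
    rw [rbL_congr_fun h n (f := fun _ => ε) (f' := fun Q => ε * 1) (fun Q => by ring), rbL_smul, rbL_one h hn hKn]
  have hneg : rbL h n (fun Q => cdist Q (colorVec h) - ε) < 0 := by
    rw [hleft, neg_lt_zero]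
    have hKpos : (0 : ℝ) < K := by exact_mod_cast (show 0 < K by omega)
    have hnpos : (0 : ℝ) < n := by exact_mod_cast (show 0 < n by omega)
    positivity
  -- right side: each junta integrates to `∑_P F_l(P) μ_{S_l}(P) ≥ 0`
  have hright : 0 ≤ rbL h n (fun Q => ∑ l, F l (Q ∩ S l)) := by
    rw [rbL_sum]
    refine Finset.sum_nonneg fun l _ => ?_
    have hexp : ∀ Q : Finset (Fin m), F l (Q ∩ S l) =
        ∑ P ∈ (S l).powerset, F l P * (if Q ∩ S l = P then (1 : ℝ) else 0) := by
      intro Q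
      rw [Finset.sum_eq_single_of_mem (Q ∩ S l) (mem_powerset.2 inter_subset_right)]
      · simp
      · intro P _ hP
        rw [if_neg (Ne.symm hP), mul_zero]
    rw [rbL_congr_fun h n hexp, rbL_sum]
    refine Finset.sum_nonneg fun P hP => ?_
    rw [rbL_smul]
    exact mul_nonneg (hF l P) (rbL_localLaw_nonneg h hn hK hKn ht (mem_powerset.1 hP) (hS l))
  rw [hL] at hneg
  exact absurd hright (not_le.2 hneg)

/-- **No junta factorisation of the colouring columns of `D - εJ`.** For every `ε > 0` the colouring columns of the
canonical matrix of the crux admit no non-negative factorisation `cdist Q (colorVec h) - ε = ∑_l W_{h,l} G_l(Q ∩ S_l)`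
with `W ≥ 0`, `G_l ≥ 0` and `#S_l ≤ t` (`2 ≤ K`, `K + 1 ≤ n`, `2t ≤ K`, one balanced colouring `h₀` suffices), whatever
the index type. [new] -/
theorem cdist_colorVec_no_juntaFactorisation (h₀ : Fin m → Fin K) {n t : ℕ} (hn : ∀ c, (cls h₀ c).card = n)
    (hK : 2 ≤ K) (hKn : K + 1 ≤ n) (ht : 2 * t ≤ K) {ε : ℝ} (hε : 0 < ε) {ι : Type*} [Fintype ι]
    (S : ι → Finset (Fin m)) (hS : ∀ l, (S l).card ≤ t) (G : ι → Finset (Fin m) → ℝ) (hG : ∀ l P, 0 ≤ G l P)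
    (W : (Fin m → Fin K) → ι → ℝ) (hW : ∀ h l, 0 ≤ W h l) :
    ¬ ∀ (Q : Finset (Fin m)) (h : Fin m → Fin K), Q.card = K + 1 →
        cdist Q (colorVec h) - ε = ∑ l, W h l * G l (Q ∩ S l) := by
  intro hfac
  exact cdist_colorVec_not_juntaRep h₀ hn hK hKn ht hε S (fun l P => W h₀ l * G l P) hS
    (fun l P => mul_nonneg (hW h₀ l) (hG l P)) (fun Q hQ => hfac Q h₀ hQ)

/-- **Locality, not the cone, is what is blind.** The same holds for mixed `PSD ⊕ ℝ₊` factorisations in the shape of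
the canonical form of the crux as soon as the ROW objects are juntas: if `Y_Q = Y(Q ∩ S₀)` (`#S₀ ≤ t`, values PSD) and
`V_l(Q) = G_l(Q ∩ S_l)` (`G_l ≥ 0`, `#S_l ≤ t`), then for every `ε > 0` there are no PSD `H_h` and `W ≥ 0` with
`cdist Q (colorVec h) - ε = tr(H_h Y_Q) + ∑_l W_{h,l} V_l(Q)` on the `(K+1)`-sets (`Q ↦ tr(H_h Y(Q ∩ S₀))` is itself a
non-negative junta). Contrast: the theta certificate (`…ColouringTheta.lean`) factorises these columns with `Y_Q = 1_Q 1_Qᵀ`,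
which depends on all of `Q`. [new] -/
theorem cdist_colorVec_no_juntaConeFactorisation (h₀ : Fin m → Fin K) {n t : ℕ} (hn : ∀ c, (cls h₀ c).card = n)
    (hK : 2 ≤ K) (hKn : K + 1 ≤ n) (ht : 2 * t ≤ K) {ε : ℝ} (hε : 0 < ε) {q : ℕ} {ι : Type*} [Fintype ι]
    (S₀ : Finset (Fin m)) (hS₀ : S₀.card ≤ t) (Y : Finset (Fin m) → Matrix (Fin q) (Fin q) ℝ)
    (hY : ∀ P, (Y P).PosSemidef) (H : (Fin m → Fin K) → Matrix (Fin q) (Fin q) ℝ) (hH : ∀ h, (H h).PosSemidef)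
    (S : ι → Finset (Fin m)) (hS : ∀ l, (S l).card ≤ t) (G : ι → Finset (Fin m) → ℝ) (hG : ∀ l P, 0 ≤ G l P)
    (W : (Fin m → Fin K) → ι → ℝ) (hW : ∀ h l, 0 ≤ W h l) :
    ¬ ∀ (Q : Finset (Fin m)) (h : Fin m → Fin K), Q.card = K + 1 →
        cdist Q (colorVec h) - ε = (H h * Y (Q ∩ S₀)).trace + ∑ l, W h l * G l (Q ∩ S l) := by
  classical
  intro hfac
  refine cdist_colorVec_not_juntaRep h₀ hn hK hKn ht hε (ι := Option ι) (fun o => o.elim S₀ S)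
    (fun o P => o.elim ((H h₀ * Y P).trace) (fun l => W h₀ l * G l P)) ?_ ?_ ?_
  · intro o; cases o with
    | none => exact hS₀
    | some l => exact hS l
  · intro o P; cases o with
    | none => exact Literature.Combinatorics.SimpleGraph.trace_mul_nonneg_of_posSemidef (hH h₀) (hY P)
    | some l => exact mul_nonneg (hW h₀ l) (hG l P)
  · intro Q hQ
    rw [hfac Q h₀ hQ, Fintype.sum_option]
    rfl

/-- **Registered helper stub (junta LPs are ε-exactly blind on colouring columns).** Restatement of
`cdist_colorVec_not_juntaRep` with all parameters explicit. -/
theorem junta_blind : ∀ {m K n t : ℕ} (h : Fin m → Fin K), (∀ c, (cls h c).card = n) → 2 ≤ K → K + 1 ≤ n → 2 * t ≤ K → ∀ (ε : ℝ), 0 < ε → ∀ {ι : Type} [Fintype ι] (S : ι → Finset (Fin m)) (F : ι → Finset (Fin m) → ℝ), (∀ l, (S l).card ≤ t) → (∀ l P, 0 ≤ F l P) → ¬ ∀ Q : Finset (Fin m), Q.card = K + 1 → cdist Q (colorVec h) - ε = ∑ l, F l (Q ∩ S l) := by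
  intro m K n t h hn hK hKn ht ε hε ι _ S F hS hF
  exact cdist_colorVec_not_juntaRep h hn hK hKn ht hε S F hS hF

end

end Summit.PneNP.PneNP.Theorems
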